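import Summits.Ventures.HSemireg.CensusG6Verdict
import Summits.Ventures.HSemireg.CensusG10
import Summits.Ventures.HSemireg.StructureLadderG2n
import Summits.Ventures.HSemireg.AmplificationChainSigmaGluable
import HarnessLib

/-!
# Venture HSemireg — § V-1 (g = 6) of the SIGNED verdict as ONE kernel conjunction: the certified negative on the deciding
# rows of the census of record ∧ what ONE seed on a member of a non-split sixfold cell WOULD give (door-agnostic and route (C))

HONEST FRAMING. Assembly leaf of a COMPUTATION cell (`pub-hsemireg`, Sunday typer seat p11 «assembly g = 2n», successor generation;
referees ref-3 ∕ ref-4). It WIRES, without restating, (i) the g = 6 census of record as kernel data and its certified negative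
(`CensusG6Table.lean` ∕ `CensusG6Verdict.lean`: CENSUS (g = 6) v3.77 `5d64c8087faa95c9`, signed pin v3.75 `9ce5a28eeae1edae`;
three-outcome form on the DECIDING rows = «NO-in-families-tried», SEMIREG ∧ CLASS on a non-split component = 0, the 17
both-halves rows all SPLIT), (ii) the door-agnostic `g = 6` cell form of the amplification chain
(`weilSixfoldComponent_of_localVariationalHodgeFor_of_seedOn_member`, `ComponentCellsRouteC.lean`) and its route-(C) rank-door,
σ-door and gluable-σ-class specialisations, (ii′) the g = 10 census (`CensusG10.lean`) with the `N = 5` ladder reading, and (iii) the split reading at `N = 3` of the level-`N` ladder (`StructureLadderG2n.lean` §2) — into the g = 6 twin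
of `g8_noInFamiliesTried_and_conditional`. NOTHING about any explicit variety is asserted: the census half is bookkeeping of a
transcribed table (no engine number recomputed), the conditional half is an implication whose antecedent — ONE seed of class `𝒪`
on a member of a non-split cell (3, d, δ) — is, by the census half, supplied by NO row of record. Named hypotheses BY NAME:
Deligne's reach (`weilFamilyReach_similar` for cells ∕ `weilFamilyReach_hyperbolic` for the split reading; REFEREED tree facts)
and a local variational Hodge statement for the object class, `LocalVariationalHodgeFor 𝒪` (for `𝒪 = rankObjClass C` it is the
venture's ASSUMPTION `PerfectComplexRankTransfer C`, F-1: of printed strength on paper via [BuchweitzFlenner2008HH] Prop. 6.4.4 +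
[Pridham2024Semiregularity] Cor. 2.25 ∕ Rem. 2.27 ∕ [Perry2022] Prop. 8.1 — the kernel links it to none of them). 0 `sorry`, 0 `def`,
0 new named fact. NOTHING HERE SAYS THAT HC, HC_CM OR HC_AV IS PROVED OR REFUTED; «STRUCTURAL-NO» is not claimed either.

THE SIGNED WORDS (VERDICT-G6.md v1.0 `1651dcc7322662a2`, V-1): «FORM AT g = 6 … deciding rows = the NON-SPLIT components (3, K, a) …:
NO-in-families-tried. On every non-split g = 6 component of record, 0 objects pass CLASS-EXACTNESS … AND SEMIREGULARITY …;
candidates 0»; «YES as METHOD INSTANCES on split components; STRUCTURAL-NO NOT CLAIMED».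
-/

open CategoryTheory AlgebraicGeometry
open Literature.AlgebraicGeometry Literature.AlgebraicGeometry.Motives Literature.AlgebraicGeometry.HodgeTheory
open Literature.AlgebraicGeometry.ModuliOfAbelianVarieties Literature.AlgebraicGeometry.Deligne1982
open Literature.AlgebraicGeometry.KTheory Literature.AlgebraicGeometry.VanGeemen1994
open Literature.AlgebraicTopology.SingularHomology

namespace Summit.Ventures.HSemireg

open Summit.HodgeConjecture.HodgeConjecture
open Summit.HodgeConjecture.HodgeConjecture.WeilTypeLadder
open Summit.HodgeConjecture.HodgeConjecture.Cruxes.HodgeAbelianVarieties.EStepSecantInduction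
open Summit.HodgeConjecture.HodgeConjecture.Ring2.Hypotheses
open Summit.HodgeConjecture.HodgeConjecture.Ring2.AbelianAll
open Summit.Ventures.HSemireg.GeneralStructure

section G6

variable {𝒪 : ObjClass}

/-- **§ V-1 of the signed verdict as ONE kernel conjunction, door-agnostic currency.** (a) DATA HALF: the coordinator's three-outcome
form evaluated on the DECIDING rows (n = 3, read on a non-split component) of the g = 6 census of record is «NO-in-families-tried»
(`CensusG6.outcome_g6`: no deciding row is SEMIREG ∧ CLASS, no all-object barrier row). (b) CONDITIONAL HALF (the deciding-row
form of the amplification chain at `n = 3`, `weilSixfoldComponent_of_localVariationalHodgeFor_of_seedOn_member`): granting BY NAME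
Deligne's reach-by-similitude and `LocalVariationalHodgeFor 𝒪`, a polarized Weil-type `(3, d)` member `(P, ψ₀, h_K)` of the sixfold
cell `δ` (its Gram placement `HasWeilDiscriminantNondeg`), a non-zero rational Weil class `w`, and ONE seed of class `𝒪` on it
(`HasSeedOn 𝒪 3 P h_K w`: `κ₃ = q·h_K³ + w`, `κ_p = c_p·h_Kᵖ`) WOULD give `WeilClassesComponent 3 d δ` — HC for the Weil classes on
that whole component, the non-split (deciding) cells included. By (a) no row of record supplies such a seed on a non-split cell;
nothing is instantiated. [bookkeeping ∧ cite: Deligne1982HodgeCycles, proof of Thm. 4.8] -/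
theorem g6_noInFamiliesTried_and_conditional (hF : weilFamilyReach_similar) (hT : LocalVariationalHodgeFor 𝒪) :
    CensusG6.outcome CensusG6.census = .noInFamiliesTried ∧
      ∀ (d : ℕ) (δ : weilNormResidueGroup d) (P : AbelianVariety ℂ) (ψ₀ : P ⟶ P) (_ : IsWeilType P ψ₀ 3 d)
        (e : ProjectiveEmbedding P.X) (a : complexBetti (projectiveSpace e.n ℂ) 2) (_ : IsRationalClass a) (_ : a ≠ 0)
        (_ : HasWeilDiscriminantNondeg P ψ₀ 3 d (symmetrisedClass d P ψ₀ e a) δ)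
        (w : complexBetti P.X 6) (_ : w ∈ weilClassesOf P ψ₀ 3 d) (_ : IsRationalClass w) (_ : w ≠ 0),
        HasSeedOn 𝒪 3 P (symmetrisedClass d P ψ₀ e a) w → WeilClassesComponent 3 d δ :=
  ⟨CensusG6.outcome_g6, fun _ _ _ _ hW e _ haQ ha0 hδ _ hwW hwQ hw0 hS ↦
    weilSixfoldComponent_of_localVariationalHodgeFor_of_seedOn_member hF hT hW e haQ ha0 hδ hwW hwQ hw0 hS⟩

/-- **The split half of V-1 («YES as METHOD INSTANCES on split components») as ONE kernel conjunction.** (a) DATA HALF: the g = 6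
rows of the census with BOTH halves are, by name, the 17 rows B11-8 (= D-1), C13-8 ∕ 10 ∕ 12 ∕ 13 ∕ 16, C14-3 ∕ 5 ∕ 8 ∕ 11 ∕ 12,
D-1…D-6 — every one read on a SPLIT component (`CensusG6.semiregAndClass_rows_g6`). (b) CONDITIONAL HALF (the `N = 3` rung of the
level-`N` ladder, `sixfoldSplit_and_fourfolds_of_reach_of_localVariationalHodgeFor_of_hyperbolicSeedOn_three`): granting BY NAME
Deligne's hyperbolic reach and `LocalVariationalHodgeFor 𝒪`, ONE hyperbolic (split-anchor) seed of class `𝒪` at level 3 for the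
field ℚ(√−d) gives the Weil classes on EVERY split ℚ(√−d)-Weil sixfold, on every ℚ(√−d)-Weil fourfold, and on every fourfold cell
— print territory ([Mar25] Thm. 1.5.1 ∕ [Sch88] for d = 3), «never the g = 6 answer». The census rows are DATA here: no row is
turned into a `HasHyperbolicSeedOn` witness by this file (that is the object-side work of seat p8's `MethodInstanceG6ThetaSecant.lean` ∕
`MethodInstanceG6ExtremalFactors.lean` on real carriers). [bookkeeping ∧ cite: Deligne1982HodgeCycles, proof of Thm. 4.8] -/
theorem g6_splitInstances_and_conditional (hF : weilFamilyReach_hyperbolic) (hT : LocalVariationalHodgeFor 𝒪) :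
    (CensusG6.ids CensusG6.census (fun r => r.atThree && r.semiregAndClass) =
        ["B11-8", "C13-8", "C13-10", "C13-12", "C13-13", "C13-16", "C14-3", "C14-5", "C14-8", "C14-11", "C14-12", "D-1", "D-2",
         "D-3", "D-4", "D-5", "D-6"] ∧
      ∀ r ∈ CensusG6.census, r.atThree = true → r.semiregAndClass = true → r.component = .split) ∧
    ∀ d : ℕ, 0 < d → HasHyperbolicSeedOn 𝒪 3 d →
      Stubs.WeilAlgebraicSplitHyperplane 3 d ∧ WeilAlgebraicAll 2 d ∧ ∀ δ : weilNormResidueGroup d, WeilClassesComponent 2 d δ :=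
  ⟨CensusG6.semiregAndClass_rows_g6,
    fun _ hd hS ↦ sixfoldSplit_and_fourfolds_of_reach_of_localVariationalHodgeFor_of_hyperbolicSeedOn_three hF hT hd hS⟩

end G6

section RouteC

variable (C : ChernCharacterBetti)

/-- **§ V-1 as one kernel conjunction, ROUTE (C) rank door** (`𝒪 = rankObjClass C`): the data half as above; the conditional half
under BY NAME `weilFamilyReach_similar` (REFEREED) and the venture's ASSUMPTION `PerfectComplexRankTransfer C` (F-1: the local
variational Hodge statement for rank-admissible bounded complexes of vector bundles — `{1,2,3} ⊆ I`, `Ext^{<0} = 0`, `Hom = ℂ`,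
`rank Ext² ≤ r(P, ch E)`; no kernel link to its printed sources): ONE such complex on a member of a non-split sixfold cell with
`ch₃ = q·h_K³ + w`, `ch_p = c_p·h_Kᵖ` WOULD give `WeilClassesComponent 3 d δ`; by the data half no census row supplies one.
[bookkeeping ∧ cite: BuchweitzFlenner2008HH, Prop. 6.4.4] [cite: Pridham2024Semiregularity, Cor. 2.25, Rem. 2.27]
[cite: Deligne1982HodgeCycles, proof of Thm. 4.8] -/
theorem g6_noInFamiliesTried_and_conditional_rank (hF : weilFamilyReach_similar) (hT : PerfectComplexRankTransfer C) :
    CensusG6.outcome CensusG6.census = .noInFamiliesTried ∧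
      ∀ (d : ℕ) (δ : weilNormResidueGroup d) (P : AbelianVariety ℂ) (ψ₀ : P ⟶ P) (_ : IsWeilType P ψ₀ 3 d)
        (e : ProjectiveEmbedding P.X) (a : complexBetti (projectiveSpace e.n ℂ) 2) (_ : IsRationalClass a) (_ : a ≠ 0)
        (_ : HasWeilDiscriminantNondeg P ψ₀ 3 d (symmetrisedClass d P ψ₀ e a) δ)
        (w : complexBetti P.X 6) (_ : w ∈ weilClassesOf P ψ₀ 3 d) (_ : IsRationalClass w) (_ : w ≠ 0),
        HasSeedOn (rankObjClass C) 3 P (symmetrisedClass d P ψ₀ e a) w → WeilClassesComponent 3 d δ :=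
  g6_noInFamiliesTried_and_conditional hF hT.localVariationalHodgeFor

/-- **Route (C), split half**: the 17 split both-halves rows by name ∧ (hyperbolic reach ∧ `PerfectComplexRankTransfer C` ∧ ONE
rank-admissible hyperbolic seed at level 3 ⟹ every split ℚ(√−d)-Weil sixfold, every ℚ(√−d)-Weil fourfold and every fourfold
cell) — the currency in which seat p8's `weilSixfoldsSplit_and_fourfoldsAll_of_reach_of_perfectComplexRankTransfer_of_thetaSecant`
delivers the THETA-SECANT rows D-2…D-6 on real carriers. [bookkeeping ∧ cite: BuchweitzFlenner2008HH, Prop. 6.4.4]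
[cite: Deligne1982HodgeCycles, proof of Thm. 4.8] -/
theorem g6_splitInstances_and_conditional_rank (hF : weilFamilyReach_hyperbolic) (hT : PerfectComplexRankTransfer C) :
    (CensusG6.ids CensusG6.census (fun r => r.atThree && r.semiregAndClass) =
        ["B11-8", "C13-8", "C13-10", "C13-12", "C13-13", "C13-16", "C14-3", "C14-5", "C14-8", "C14-11", "C14-12", "D-1", "D-2",
         "D-3", "D-4", "D-5", "D-6"] ∧
      ∀ r ∈ CensusG6.census, r.atThree = true → r.semiregAndClass = true → r.component = .split) ∧
    ∀ d : ℕ, 0 < d → HasHyperbolicSeedOn (rankObjClass C) 3 d →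
      Stubs.WeilAlgebraicSplitHyperplane 3 d ∧ WeilAlgebraicAll 2 d ∧ ∀ δ : weilNormResidueGroup d, WeilClassesComponent 2 d δ :=
  g6_splitInstances_and_conditional hF hT.localVariationalHodgeFor

end RouteC

section OtherDoors

variable (C : ChernCharacterBetti)

/-- **§ V-1 as one kernel conjunction, σ-DOOR** (`𝒪 = sigmaObjClass C`, target seat t-7's door): the data half as above; the
conditional half under BY NAME `weilFamilyReach_similar` (REFEREED) and the venture's ASSUMPTION `PerfectComplexSigmaTransfer C`
(claim-grade printed shape [Perry2026] Thm. 1.1 ∕ refereed chain [Perry2022] Prop. 8.1 + [Pridham2024Semiregularity] + [Lieblich2006];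
no kernel link): ONE strictly perfect complex on a member of a non-split sixfold cell with `Ext^{<0} = 0`, `Hom = ℂ`,
`(σ_q)_{q+1 ∈ I}` jointly injective and the class shape WOULD give `WeilClassesComponent 3 d δ`; no census row supplies one.
[bookkeeping ∧ cite: Perry2022, Prop. 8.1] [cite: Deligne1982HodgeCycles, proof of Thm. 4.8] -/
theorem g6_noInFamiliesTried_and_conditional_sigma (hF : weilFamilyReach_similar) (hT : PerfectComplexSigmaTransfer C) :
    CensusG6.outcome CensusG6.census = .noInFamiliesTried ∧
      ∀ (d : ℕ) (δ : weilNormResidueGroup d) (P : AbelianVariety ℂ) (ψ₀ : P ⟶ P) (_ : IsWeilType P ψ₀ 3 d)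
        (e : ProjectiveEmbedding P.X) (a : complexBetti (projectiveSpace e.n ℂ) 2) (_ : IsRationalClass a) (_ : a ≠ 0)
        (_ : HasWeilDiscriminantNondeg P ψ₀ 3 d (symmetrisedClass d P ψ₀ e a) δ)
        (w : complexBetti P.X 6) (_ : w ∈ weilClassesOf P ψ₀ 3 d) (_ : IsRationalClass w) (_ : w ≠ 0),
        HasSeedOn (sigmaObjClass C) 3 P (symmetrisedClass d P ψ₀ e a) w → WeilClassesComponent 3 d δ :=
  g6_noInFamiliesTried_and_conditional hF hT.localVariationalHodgeFor

/-- **§ V-1 as one kernel conjunction, GLUABLE σ-class on the split trust base** (`𝒪 = perfectObjClass C gluableSigmaAdmissible`, no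
`Hom = ℂ`; `AmplificationChainSigmaGluable.lean`): the data half as above; the conditional half under BY NAME `weilFamilyReach_similar`
(REFEREED), (F) `PridhamPerfectLifts C` (Pridham 2024's printed + refereed statement, typed venture-side; undischarged) and (E)+(C)
`PerfectComplexAlgebraisesLifts C` (Hodge-free; kernel-linked to nothing — on rung R5 it follows from Lieblich-type versal charts with
EGA IV 17 KERNEL): ONE bounded complex of vector bundles with `Ext^{<0} = 0`, `(σ_q)_{q+1 ∈ I}` jointly injective and the class shape
on a member of a non-split sixfold cell WOULD give `WeilClassesComponent 3 d δ`; no census row supplies one.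
[bookkeeping ∧ cite: Pridham2024Semiregularity, Cor. 2.25; Rem. 2.27] [cite: Perry2022, proof of Prop. 8.1]
[cite: Deligne1982HodgeCycles, proof of Thm. 4.8] -/
theorem g6_noInFamiliesTried_and_conditional_gluable (hF : weilFamilyReach_similar) (hP : PridhamPerfectLifts C)
    (hA : PerfectComplexAlgebraisesLifts C) :
    CensusG6.outcome CensusG6.census = .noInFamiliesTried ∧
      ∀ (d : ℕ) (δ : weilNormResidueGroup d) (P : AbelianVariety ℂ) (ψ₀ : P ⟶ P) (_ : IsWeilType P ψ₀ 3 d)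
        (e : ProjectiveEmbedding P.X) (a : complexBetti (projectiveSpace e.n ℂ) 2) (_ : IsRationalClass a) (_ : a ≠ 0)
        (_ : HasWeilDiscriminantNondeg P ψ₀ 3 d (symmetrisedClass d P ψ₀ e a) δ)
        (w : complexBetti P.X 6) (_ : w ∈ weilClassesOf P ψ₀ 3 d) (_ : IsRationalClass w) (_ : w ≠ 0),
        HasSeedOn (perfectObjClass C gluableSigmaAdmissible) 3 P (symmetrisedClass d P ψ₀ e a) w → WeilClassesComponent 3 d δ :=
  g6_noInFamiliesTried_and_conditional hF (localVariationalHodgeFor_gluable_of_pridhamPerfect_of_algebraisesLifts hP hA)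

end OtherDoors


section G10

variable {𝒪 : ObjClass}

/-- **§ g = 10 ∕ FAMILY S of the signed verdict as ONE kernel conjunction** («family S, n = 5: no witness»): (a) DATA HALF — in the g = 10
census of record no n = 5 row, on a non-split component OR on the split (ladder) component, is class-exact ∧ W-alive ∧ semiregular
(`CensusG10.no_semireg_and_class_at_g10`; the class-live family-S skeleton ideals all fail or lack the σ half); (b) CONDITIONAL HALF —
the LADDER reading at `N = 5` (p11 g0's `tenfoldSplit_and_below_of_reach_of_localVariationalHodgeFor_of_hyperbolicSeedOn_five`):
granting BY NAME Deligne's hyperbolic reach and `LocalVariationalHodgeFor 𝒪`, ONE hyperbolic (split-anchor) seed of class `𝒪` at level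
5 for ℚ(√−d) WOULD give every split ℚ(√−d)-Weil tenfold and EVERY ℚ(√−d)-Weil eightfold, sixfold and fourfold — which is why a
family-S witness on the split (5, K) component would have decided the cell's g = 6 ∕ g = 8 questions; by (a) there is none.
[bookkeeping ∧ cite: Deligne1982HodgeCycles, proof of Thm. 4.8] -/
theorem g10_noWitness_and_ladderConditional (hF : weilFamilyReach_hyperbolic) (hT : LocalVariationalHodgeFor 𝒪) :
    (∀ r ∈ CensusG10.census, r.atFive = true → r.semiregAndClass = false) ∧
    ∀ d : ℕ, 0 < d → HasHyperbolicSeedOn 𝒪 5 d →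
      Stubs.WeilAlgebraicSplitHyperplane 5 d ∧ WeilAlgebraicAll 4 d ∧ WeilAlgebraicAll 3 d ∧ WeilAlgebraicAll 2 d :=
  ⟨CensusG10.no_semireg_and_class_at_g10,
    fun _ hd hS ↦ tenfoldSplit_and_below_of_reach_of_localVariationalHodgeFor_of_hyperbolicSeedOn_five hF hT hd hS⟩

end G10

section Censuses

/-- **The two signed census sections as one kernel pair**: the three-outcome form on the deciding rows of the g = 6 census (this
seat) and on the g = 8 census (seat p9, `CensusG8.outcome_g8`; in dimension 8 all rows are deciding) both read
«NO-in-families-tried» — V-1 and § g = 8 of VERDICT-G6.md v1.0. Bookkeeping of two transcribed tables; nothing about any variety.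
[bookkeeping] -/
theorem outcomes_g6_g8 :
    (CensusG6.outcome CensusG6.census, CensusG8.outcome CensusG8.census) = (.noInFamiliesTried, .noInFamiliesTried) :=
  Prod.ext CensusG6.outcome_g6 CensusG8.outcome_g8

/-- **All three censuses of the cell (g = 6, 8, 10) as one kernel triple**: the three-outcome form reads «NO-in-families-tried» on the
deciding rows of each (g = 10: § g = 10 ∕ FAMILY S appendix, `CensusG10.outcome_g10`). [bookkeeping] -/
theorem outcomes_g6_g8_g10 :
    (CensusG6.outcome CensusG6.census, CensusG8.outcome CensusG8.census, CensusG10.outcome CensusG10.census) =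
      (.noInFamiliesTried, .noInFamiliesTried, .noInFamiliesTried) := by
  rw [CensusG6.outcome_g6, CensusG8.outcome_g8, CensusG10.outcome_g10.1]

end Censuses

end Summit.Ventures.HSemireg
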